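import Summits.BirchSwinnertonDyer.BirchSwinnertonDyer.Theorems.PrintCFramBottomClassIndexLawFiveLeLevelDictionaryBeta
import Summits.BirchSwinnertonDyer.BirchSwinnertonDyer.Theorems.RamifiedSevenEllipticUnitsStrictControlAnyPrime
import HarnessLib

/-!
# Route `PrintCFram`, crux C2 `BottomClassIndexLawFiveLe` (stmt-BirchSwinnertonDyer-20372), line
# `eisenstein-resource-bdp-line` (registry v18; LEAD g10 report §2(d)(β), §4, ADDENDUM 1):
# **THE LEVEL DICTIONARY (β), RANK-ZERO TWIN** — on a curve whose Mordell–Weil group is `p`-divisible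
# (e.g. FINITE with no `p`-torsion) an everywhere-unramified non-zero class of the SUB line is VISIBLE IN `Ш`
# (cell `bsd-print-cfram`, width seat `bsd-line-cfram-p1-w5` g3; helper `--supports` 20372; 0 defs, 0 facts,
# 0 sorry)

HONEST FRAMING. Nothing about BSD is proved here, and nothing of any stub. w4 g8's (β, Galois half)
`LevelDictionary.levelPos_or_sha_of_unramified_sub_class` (p669667) says: an everywhere-unramified non-zero
class of `Φ.Sub` (Φ ≤ `W[p]` a stable line, quotient with no `Γ_K`-invariants, sub ramified above `p`,
`W(K_v)[p] = 0` at the bad `v ∤ p`) is either visible in `Ш(W/K)[p]` or is the Kummer class of a point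
`P' ∈ W(K)` which is NOT `p`-divisible in `W(K)` (and has LEVEL ≥ 1 above `p`). When EVERY point of `W(K)` is
`p`-divisible the second alternative is void:

* §1 `exists_zsmul_eq_of_forall_nsmul_eq_zero` — a finite abelian group with no `p`-torsion is
  `p`-divisible (multiplication by `p` is injective, hence onto); `forall_nsmul_eq_zero_of_baseChange` —
  `W(L)[p] = 0` for a field extension `L/K` gives `W(K)[p] = 0` (`W(K) ↪ W(L)`).
* §2 **`sha_of_unramified_sub_class_of_forall_divisible`** — p669667 ⊕ «`W(K)` is `p`-divisible» ⟹
  `∃ c ∈ Ш(W/K), c ≠ 0 ∧ p • c = 0`; **`sha_of_unramified_sub_class_of_finite`** — the same from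
  «`W(K)` finite and `W(K)[p] = 0`».
* §3 **`sha_of_unramified_sub_class_of_finite_cmRamified`** — the CLASS form over `ℚ`: for `W/ℚ` globally
  minimal with CM, `p ≥ 5` CM-RAMIFIED (so `W(ℚ_p)[p] = 0`,
  `RamifiedSevenEllipticUnits.prime_nsmul_eq_zero_padic_of_hasCM_of_cmRamified`, hence `W(ℚ)[p] = 0`) and
  `W(ℚ)` FINITE, an everywhere-unramified non-zero class of the sub line of a stable line `Φ ≤ W[p]` (with
  the three local clauses of p669667) gives a NON-ZERO element of `Ш(W/ℚ)[p]`.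

This is the descent half of LEAD g10 ADDENDUM 1's reading of B2′ (`stub_bsdp_of_noAdmissibleHeegnerField`) as
an `L`-VALUE statement: an Eisenstein-IRREGULAR RANK-ZERO member (the Heegner twist `W^{(d)}` of a B2′ member,
whose odd character carries a Mazur–Wiles class) has `Ш[p] ≠ 0` on the model whose sub line carries that
class; the class-group half (Mazur–Wiles ⟹ the unramified class) is w6 g2's `…HerbrandOddIrregularWitness*`
and w4 g8's link. THEOREMS ONLY; no definition, no named fact, no `sorry`. BSD is not proved by any of
this; no summit statement is proved by this seat. References: [SilvermanAEC2009] VIII.§2, X.§4 (Thm. 4.2);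
[MilneADT2006] I.§6; [GreenbergLNM1716] §3; the LEAD g10 report §2(d), §4, ADDENDUM 1.
-/

set_option autoImplicit false
-- `…BirchSwinnertonDyer.BirchSwinnertonDyer.Theorems…` is the problem's mandated namespace (D-0017).
set_option linter.dupNamespace false

noncomputable section

open scoped Classical

namespace Summit.BirchSwinnertonDyer.BirchSwinnertonDyer.Theorems.PrintCFram.LevelDictionary

open NumberField IsDedekindDomain Field WeierstrassCurve
open Literature.NumberTheory.EllipticCurves Literature.NumberTheory.GaloisRepresentations
  Literature.NumberTheory.EllipticCurves.GreenbergSelmer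
open Literature.NumberTheory.EllipticCurves.Rank1Residual (CMRamified)
open Summit.BirchSwinnertonDyer.Rank1Residual
open Summit.BirchSwinnertonDyer.Rank1Residual.X11b

/-! ## §1 `p`-divisibility of a finite group with no `p`-torsion; no `p`-torsion descends along a base change -/

section Algebra

variable {G : Type*} [AddCommGroup G]

/-- **A finite abelian group with no `p`-torsion is `p`-divisible**: multiplication by `p` is an injective
endomorphism of a finite set, hence surjective. [cite: SilvermanAEC2009, VIII.§2 (the weak Mordell–Weil
bookkeeping)] -/
theorem exists_zsmul_eq_of_forall_nsmul_eq_zero [Finite G] (p : ℕ) (h : ∀ x : G, p • x = 0 → x = 0)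
    (y : G) : ∃ x : G, (p : ℤ) • x = y := by
  have hinj : Function.Injective fun x : G ↦ (p : ℤ) • x := by
    intro a b hab
    have h0 : (p : ℤ) • (a - b) = 0 := by
      simp only [zsmul_sub, sub_eq_zero]
      exact hab
    have := h (a - b) (by rw [← natCast_zsmul]; exact h0)
    exact sub_eq_zero.1 this
  obtain ⟨x, hx⟩ := Finite.surjective_of_injective hinj y
  exact ⟨x, hx⟩

end Algebra

section Descend

variable {K : Type} [Field K] (W : WeierstrassCurve K) {L : Type} [Field L] [Algebra K L]

/-- **No `p`-torsion descends**: if `W(L)[p] = 0` for a field extension `L/K` then `W(K)[p] = 0`, since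
`W(K) → W(L)` is an injective group homomorphism (`WeierstrassCurve.Affine.Point.map_injective`).
[cite: SilvermanAEC2009, VIII.§2] -/
theorem forall_nsmul_eq_zero_of_baseChange (p : ℕ)
    (h : ∀ Q : (W.baseChange L).toAffine.Point, p • Q = 0 → Q = 0) :
    ∀ P : W.toAffine.Point, p • P = 0 → P = 0 := by
  intro P hP
  -- `f : W(K) → W(L)`, an injective group homomorphism
  have hinj := Affine.Point.map_injective (W' := W) (F := K) (K := L) (Algebra.ofId K L)
  have h1 : (p • Affine.Point.baseChange (W' := W) K L P) = Affine.Point.baseChange (W' := W) K L (p • P) :=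
    (map_nsmul (Affine.Point.baseChange (W' := W) K L) p P).symm
  have h2 : Affine.Point.baseChange (W' := W) K L (p • P) = Affine.Point.baseChange (W' := W) K L 0 :=
    congrArg _ hP
  have h3 : Affine.Point.baseChange (W' := W) K L (0 : W.toAffine.Point) = 0 :=
    map_zero (Affine.Point.baseChange (W' := W) K L)
  have h4 : Affine.Point.baseChange (W' := W) K L P = 0 := h _ (h1.trans (h2.trans h3))
  exact hinj (h4.trans h3.symm)

end Descend

/-! ## §2 (β, rank-zero twin): a `p`-divisible Mordell–Weil group makes the unramified class visible in `Ш` -/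

section Beta

variable {K : Type} [Field K] [NumberField K] (W : WeierstrassCurve K) [W.IsElliptic]

/-- **(β, RANK-ZERO TWIN) AN EVERYWHERE-UNRAMIFIED CLASS OF THE SUB LINE IS VISIBLE IN `Ш` WHEN `W(K)` IS
`p`-DIVISIBLE.** Same binders as `levelPos_or_sha_of_unramified_sub_class` (w4 g8, p669667): `K` a number
field, `W/K` elliptic, `p` an odd prime, `Φ ≤ W[p]` a stable line with `Φ.Quot^{Γ_K} = 0`, `Φ.Sub` with no
vector fixed by the inertia group of `adicCompletionPrime K v` at the places `v ∣ p`, `W(K_v)[p] = 0` at the bad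
`v ∤ p`; `w : Γ_K → Φ.Sub` a continuous crossed homomorphism with NON-ZERO class, a coboundary on every
inertia group. IF every point of `W(K)` is `p`-divisible in `W(K)`, THEN `Ш(W/K)` contains a non-zero class
killed by `p`: the second alternative of p669667 (a point NOT `p`-divisible in `W(K)`) is void.
[cite: SilvermanAEC2009, Thm. X.4.2(a)] [cite: MilneADT2006, Ch. I §6] [cite: GreenbergLNM1716, §3 (PDF p. 86)] -/
theorem sha_of_unramified_sub_class_of_forall_divisible (p : ℕ) [hp : Fact p.Prime] (hp2 : p ≠ 2)
    (Φ : X2.ResidualDevissageModules.StableSubgroup (absoluteGaloisGroup K) (geomTorsion W (p : ℤ)))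
    (hQΓ : ∀ q : Φ.Quot, (∀ g : absoluteGaloisGroup K, g • q = q) → q = 0)
    (hSp : ∀ v : HeightOneSpectrum (𝓞 K), ((p : ℕ) : 𝓞 K) ∈ v.asIdeal →
      ∀ s : Φ.Sub, (∀ g ∈ (adicCompletionPrime K v).inertia (absoluteGaloisGroup K), g • s = s) → s = 0)
    (hbad : ∀ v : HeightOneSpectrum (𝓞 K), ¬ W.HasGoodReductionAt v → ((p : ℕ) : 𝓞 K) ∉ v.asIdeal →
      ∀ P : (W.baseChange (v.adicCompletion K)).toAffine.Point, p • P = 0 → P = 0)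
    (w : contOneCocycles (discreteTopRep (absoluteGaloisGroup K) Φ.Sub)) (hw : oneCocycleClass _ w ≠ 0)
    (hwI : ∀ (v : HeightOneSpectrum (𝓞 K)) (𝔓 : Ideal (absIntegers (𝓞 K) K)), 𝔓 ∈ v.primesAbove →
      ∃ s : Φ.Sub, ∀ g ∈ 𝔓.inertia (absoluteGaloisGroup K), w.1 g = g • s - s)
    (hdiv : ∀ P' : W.toAffine.Point, ∃ R : W.toAffine.Point, (p : ℤ) • R = P') :
    ∃ c ∈ W.sha, c ≠ 0 ∧ p • c = 0 := by
  rcases levelPos_or_sha_of_unramified_sub_class W p hp2 Φ hQΓ hSp hbad w hw hwI with h | ⟨P', hP', -⟩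
  · exact h
  · obtain ⟨R, hR⟩ := hdiv P'
    exact absurd hR (hP' R)

/-- **(β, RANK-ZERO TWIN, FINITE MORDELL–WEIL).** As `sha_of_unramified_sub_class_of_forall_divisible`, with the
`p`-divisibility of `W(K)` discharged from «`W(K)` is FINITE and `W(K)[p] = 0`» (§1). This is the shape of the
Heegner twists `W^{(d)}` of a rank-one class member (rank zero on the Heegner side).
[cite: SilvermanAEC2009, Thm. X.4.2(a) and VIII.§2] [cite: MilneADT2006, Ch. I §6] -/
theorem sha_of_unramified_sub_class_of_finite (p : ℕ) [hp : Fact p.Prime] (hp2 : p ≠ 2)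
    (hfin : Finite W.toAffine.Point) (hnt : ∀ P : W.toAffine.Point, p • P = 0 → P = 0)
    (Φ : X2.ResidualDevissageModules.StableSubgroup (absoluteGaloisGroup K) (geomTorsion W (p : ℤ)))
    (hQΓ : ∀ q : Φ.Quot, (∀ g : absoluteGaloisGroup K, g • q = q) → q = 0)
    (hSp : ∀ v : HeightOneSpectrum (𝓞 K), ((p : ℕ) : 𝓞 K) ∈ v.asIdeal →
      ∀ s : Φ.Sub, (∀ g ∈ (adicCompletionPrime K v).inertia (absoluteGaloisGroup K), g • s = s) → s = 0)
    (hbad : ∀ v : HeightOneSpectrum (𝓞 K), ¬ W.HasGoodReductionAt v → ((p : ℕ) : 𝓞 K) ∉ v.asIdeal →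
      ∀ P : (W.baseChange (v.adicCompletion K)).toAffine.Point, p • P = 0 → P = 0)
    (w : contOneCocycles (discreteTopRep (absoluteGaloisGroup K) Φ.Sub)) (hw : oneCocycleClass _ w ≠ 0)
    (hwI : ∀ (v : HeightOneSpectrum (𝓞 K)) (𝔓 : Ideal (absIntegers (𝓞 K) K)), 𝔓 ∈ v.primesAbove →
      ∃ s : Φ.Sub, ∀ g ∈ 𝔓.inertia (absoluteGaloisGroup K), w.1 g = g • s - s) :
    ∃ c ∈ W.sha, c ≠ 0 ∧ p • c = 0 :=
  haveI := hfin
  sha_of_unramified_sub_class_of_forall_divisible W p hp2 Φ hQΓ hSp hbad w hw hwI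
    (exists_zsmul_eq_of_forall_nsmul_eq_zero p hnt)

end Beta

/-! ## §3 The class form over `ℚ`: CM, `p ≥ 5` CM-ramified, finite Mordell–Weil -/

section Class

open Summit.BirchSwinnertonDyer.BirchSwinnertonDyer.Theorems.RamifiedSevenEllipticUnits

variable (W : WeierstrassCurve ℚ) [W.IsElliptic] [W.IsGloballyMinimal]

/-- **`W(ℚ)[p] = 0` on the class.** For `W/ℚ` globally minimal with CM and `p ≥ 5` CM-ramified,
`W(ℚ_p)[p] = 0` (`prime_nsmul_eq_zero_padic_of_hasCM_of_cmRamified`: additive potentially good reduction at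
the ramified CM prime, `p ≥ 5`), hence `W(ℚ)[p] = 0`. [cite: GreenbergLNM1716, §3 Thm. 1.2 and §4 Lemma 4.2]
[cite: SilvermanAEC2009, VII.3.1 and VIII.§2] -/
theorem forall_nsmul_eq_zero_of_cmRamified (p : ℕ) [Fact p.Prime] (hCM : W.HasCM) (h5 : 5 ≤ p)
    (hram : CMRamified W p) : ∀ P : W.toAffine.Point, p • P = 0 → P = 0 := by
  intro P hP
  -- (`W.toAffine.Point` carries `DecidableEq ℚ` in this statement and the classical instance in the generic
  -- lemma; the two additive structures agree by `Subsingleton.elim`, bridged by `convert`)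
  refine forall_nsmul_eq_zero_of_baseChange W p
    (prime_nsmul_eq_zero_padic_of_hasCM_of_cmRamified W p hCM h5 hram) P ?_
  convert hP

/-- **(β, RANK-ZERO TWIN) ON THE CLASS.** `W/ℚ` globally minimal with CM, `p ≥ 5` CM-RAMIFIED, `W(ℚ)` FINITE;
`Φ ≤ W[p]` a `Γ_ℚ`-stable line whose quotient has no `Γ_ℚ`-invariants, whose sub line has no vector fixed by
the inertia group at `p`, and with `W(ℚ_ℓ)[p] = 0` at the bad `ℓ ≠ p`; `w : Γ_ℚ → Φ.Sub` a continuous crossed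
homomorphism with non-zero class, a coboundary on every inertia group. THEN `Ш(W/ℚ)` has a NON-ZERO element
killed by `p`. (No `p`-torsion in `W(ℚ)` is automatic on the class, `forall_nsmul_eq_zero_of_cmRamified`.) This is
the descent half of «an Eisenstein-irregular rank-zero member has `Ш[p] ≠ 0` on the model whose sub line
carries the Mazur–Wiles class» (LEAD g10 ADDENDUM 1; the class itself comes from w6 g2 + w4 g8's link).
[cite: SilvermanAEC2009, Thm. X.4.2(a)] [cite: GreenbergLNM1716, §3 (PDF p. 86)] [cite: MilneADT2006, Ch. I §6] -/
theorem sha_of_unramified_sub_class_of_finite_cmRamified (p : ℕ) [hp : Fact p.Prime] (hCM : W.HasCM)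
    (h5 : 5 ≤ p) (hram : CMRamified W p) (hfin : Finite W.toAffine.Point)
    (Φ : X2.ResidualDevissageModules.StableSubgroup (absoluteGaloisGroup ℚ) (geomTorsion W (p : ℤ)))
    (hQΓ : ∀ q : Φ.Quot, (∀ g : absoluteGaloisGroup ℚ, g • q = q) → q = 0)
    (hSp : ∀ v : HeightOneSpectrum (𝓞 ℚ), ((p : ℕ) : 𝓞 ℚ) ∈ v.asIdeal →
      ∀ s : Φ.Sub, (∀ g ∈ (adicCompletionPrime ℚ v).inertia (absoluteGaloisGroup ℚ), g • s = s) → s = 0)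
    (hbad : ∀ v : HeightOneSpectrum (𝓞 ℚ), ¬ W.HasGoodReductionAt v → ((p : ℕ) : 𝓞 ℚ) ∉ v.asIdeal →
      ∀ P : (W.baseChange (v.adicCompletion ℚ)).toAffine.Point, p • P = 0 → P = 0)
    (w : contOneCocycles (discreteTopRep (absoluteGaloisGroup ℚ) Φ.Sub)) (hw : oneCocycleClass _ w ≠ 0)
    (hwI : ∀ (v : HeightOneSpectrum (𝓞 ℚ)) (𝔓 : Ideal (absIntegers (𝓞 ℚ) ℚ)), 𝔓 ∈ v.primesAbove →
      ∃ s : Φ.Sub, ∀ g ∈ 𝔓.inertia (absoluteGaloisGroup ℚ), w.1 g = g • s - s) :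
    ∃ c ∈ W.sha, c ≠ 0 ∧ p • c = 0 := by
  have hp2 : p ≠ 2 := by
    have := hp.out.two_le
    omega
  refine sha_of_unramified_sub_class_of_finite W p hp2 hfin (fun P hP ↦ ?_) Φ hQΓ hSp hbad w hw hwI
  refine forall_nsmul_eq_zero_of_cmRamified W p hCM h5 hram P ?_
  convert hP

end Class

end Summit.BirchSwinnertonDyer.BirchSwinnertonDyer.Theorems.PrintCFram.LevelDictionary

end
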